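import Literature.AlgebraicGeometry.Resolution.CartierDivisorControlledTransform
import Literature.AlgebraicGeometry.Resolution.HypersurfaceRestrictionTransform
import Literature.AlgebraicGeometry.Resolution.OrderSemicontinuityPointwise
import Literature.AlgebraicGeometry.Resolution.RegularCentreRsopGenerated
import HarnessLib

/-!
# Crux `PatchingRelPerfect` (stmt-ResolutionOfSingularities-16161), chain W5.2 — TargetsF5 (JR) X-side step:
# the GENERIC ORDER of the host along the centre, READ BACK from «not inside the exceptional divisor»

[OURS · L1 W5.2 · rung tool] Replaces the role of NO printed item; NOT a statement of the manuscript under review; fact-free.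
res-D-pv-052's `stepMixedJR_mixedFormatB` (TargetsF5 JR, instance `MixedFormatB`) steps the global host factor as the
controlled transform `σᶜ(𝓐, m)` and wants to identify it with the strict transform by res-D-pv-026's
`IsBlowup.strictTransformIdeal_eq_controlledTransform` (…/CartierDivisorControlledTransform.lean), whose hypothesis is the
GENERIC ORDER `ord_η 𝓐 = m` along the connected regular centre. The E-side step of `IsWeightedSeqJR` hands over exactly
«`D ≤ C^m`» and «`τᶜ(D, m) ⊄ C𝒪` (no exceptional component)»; on the X-side these become `𝓐 ≤ Ĉ^m` (cylinder) and
`σᶜ(𝓐, m) ⊄ Ĉ𝒪` (restriction along `i′`). This file closes the gap, converse to res-D-pv-026's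
`IsBlowup.not_controlledTransform_le_comap_of_idealOrder_genericPoint_eq`:

* `controlledTransform_le_comap_of_le_pow_succ` — `𝓗 ≤ C^{m+1} ⇒ τᶜ(𝓗, m) ≤ C𝒪` (cancel `(C𝒪)^m`);
* **`idealOrder_genericPoint_eq_of_le_pow_of_not_controlledTransform_le`** — `𝓗 ≤ C^m ∧ τᶜ(𝓗, m) ⊄ C𝒪 ⇒ ord_η 𝓗 = m`
  (`≥` from `𝓗_η ⊆ C_η^m ⊆ 𝔪_η^m`; `≤`: otherwise `ord ≥ m+1` at `η`, hence at every point of `V(C)` by the tree's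
  semicontinuity `idealOrder_le_of_specializes`, hence `𝓗 ≤ C^{m+1}` by `le_pow_of_isRegular_subscheme_of_forall_le_idealOrder`);
* **`strictTransformIdeal_eq_controlledTransform_of_le_pow_of_not_le_comap`** — the combination with res-D-pv-026's theorem.

## References
* J. Kollár, *Lectures on Resolution of Singularities* (2007), 3.30.2. [Kollar2007]
* E. Bierstone, D. Grigoriev, P. Milman, J. Włodarczyk, arXiv:1206.3090, §3.2 Lemma 3.2.1 (1). [BierstoneGrigorievMilmanWlodarczyk2011]
* V. Cossart, O. Piltant, J. Algebra 320 (2008), Prop. 4.2 (upper semicontinuity of order). [CossartPiltant2008]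
-/

-- `Summit.<Summit>.<Sub>.Theorems` with `Sub = Summit` (single-conjunct summit, D-0017)
set_option linter.dupNamespace false

noncomputable section

open CategoryTheory CategoryTheory.Limits AlgebraicGeometry TopologicalSpace IsLocalRing
open Literature.AlgebraicGeometry.Resolution
open Scheme.IdealSheafData

namespace Summit.ResolutionOfSingularities.ResolutionOfSingularities.Theorems

universe u

namespace DepthOrder

variable {W W' : Scheme.{u}} {τ : W' ⟶ W} {C 𝓗 : W.IdealSheafData} {η : W} {m : ℕ}

/-- **`𝓗 ≤ C^{m+1} ⇒ τᶜ(𝓗, m) ≤ C𝒪_{W′}`**: `(C𝒪)^m · τᶜ(𝓗, m) ≤ τ^*𝓗 ≤ (C𝒪)^{m+1} = (C𝒪)^m · C𝒪`, and `(C𝒪)^m` is an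
effective Cartier divisor, so it cancels. [cite: BierstoneGrigorievMilmanWlodarczyk2011, §3.2] -/
theorem controlledTransform_le_comap_of_le_pow_succ (hτ : IsBlowup τ C) (hle : 𝓗 ≤ C ^ (m + 1)) :
    controlledTransform τ C 𝓗 m ≤ C.comap τ := by
  have h1 : C.comap τ ^ m * controlledTransform τ C 𝓗 m ≤ C.comap τ ^ m * C.comap τ := by
    refine (pow_mul_controlledTransform_le τ C 𝓗 m).trans ?_
    rw [← pow_succ, ← comap_pow]
    exact Scheme.IdealSheafData.comap_mono (f := τ) hle
  exact (hτ.isEffectiveCartier.pow m).le_of_mul_le_mul h1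

/-- [OURS · L1 W5.2] **The generic order read back**: for `W` regular locally Noetherian, `V(C)` regular with generic point
`η`, `𝓗 ≤ C^m`, `τ` a blowing up along `C` with `τᶜ(𝓗, m) ⊄ C𝒪_{W′}` («the transform with weight `m` has no exceptional
component»), the order of `𝓗` at `η` is exactly `m`. [cite: Kollar2007, 3.30.2] [cite: CossartPiltant2008, Prop. 4.2] -/
theorem idealOrder_genericPoint_eq_of_le_pow_of_not_controlledTransform_le [IsLocallyNoetherian W]
    (hW : Scheme.IsRegular W) (hC : Scheme.IsRegular C.subscheme) (hη : IsGenericPoint η (C.support : Set W))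
    (hle : 𝓗 ≤ C ^ m) (hτ : IsBlowup τ C) (hnot : ¬ controlledTransform τ C 𝓗 m ≤ C.comap τ) :
    idealOrder 𝓗 η = m := by
  have hηC : η ∈ (C.support : Set W) := hη.mem
  -- `ord_η 𝓗 ≥ m`
  have hge : (m : ℕ∞) ≤ idealOrder 𝓗 η := by
    rw [le_idealOrder_iff]
    calc stalkIdeal 𝓗 η ≤ stalkIdeal (C ^ m) η := stalkIdeal_mono hle η
      _ = stalkIdeal C η ^ m := stalkIdeal_pow C m η
      _ ≤ maximalIdeal (W.presheaf.stalk η) ^ m :=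
          Ideal.pow_right_mono ((mem_support_iff_stalkIdeal_le C η).mp hηC) m
  -- `ord_η 𝓗 ≤ m`: otherwise `𝓗 ≤ C^{m+1}` and the transform would lie in the exceptional ideal
  refine le_antisymm ?_ hge
  by_contra hlt
  have hsucc : ((m + 1 : ℕ) : ℕ∞) ≤ idealOrder 𝓗 η := by
    rw [Nat.cast_add, Nat.cast_one]
    exact ENat.coe_add_one_le_iff.mpr (lt_of_not_ge hlt)
  have hall : ∀ y ∈ C.support, ((m + 1 : ℕ) : ℕ∞) ≤ idealOrder 𝓗 y := by
    intro y hy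
    haveI : IsRegularLocalRing (W.presheaf.stalk y) := hW y
    exact hsucc.trans (idealOrder_le_of_specializes (hη.specializes hy) 𝓗)
  have hle' : 𝓗 ≤ C ^ (m + 1) := le_pow_of_isRegular_subscheme_of_forall_le_idealOrder_of_isRegular hW hC hall
  exact hnot (controlledTransform_le_comap_of_le_pow_succ hτ hle')

/-- [OURS · L1 W5.2] **The host's controlled transform with the E-side weight IS its strict transform**: for `W` regular
locally Noetherian, `V(C)` regular CONNECTED (⇒ irreducible, with a generic point) and nowhere dense, `𝓗` an effective
Cartier ideal with `𝓗 ≤ C^m` and `τᶜ(𝓗, m) ⊄ C𝒪`, `strictTransformIdeal τ C 𝓗 = τᶜ(𝓗, m)` (res-D-pv-026's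
`IsBlowup.strictTransformIdeal_eq_controlledTransform` with the generic order supplied by
`idealOrder_genericPoint_eq_of_le_pow_of_not_controlledTransform_le`). The hypotheses are exactly what TargetsF5 (JR) carries
on the X-side: `𝓐 ≤ Ĉ^m` (cylinder over `D ≤ C^m`) and `σᶜ(𝓐, m) ⊄ Ĉ𝒪` (restriction of the E-side «no exceptional
component» along `i′`); so the stalk clause of `DepthSNC.pocketSNC_step_host'` is discharged globally. [cite: Kollar2007, 3.30.2] -/
theorem strictTransformIdeal_eq_controlledTransform_of_le_pow_of_not_le_comap [IsLocallyNoetherian W]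
    (hW : Scheme.IsRegular W) (hC : Scheme.IsRegular C.subscheme) (hη : IsGenericPoint η (C.support : Set W))
    (hint : interior (C.support : Set W) = ∅) (h𝓗 : IsEffectiveCartier 𝓗) (hle : 𝓗 ≤ C ^ m) (hτ : IsBlowup τ C)
    (hnot : ¬ controlledTransform τ C 𝓗 m ≤ C.comap τ) :
    strictTransformIdeal τ C 𝓗 = controlledTransform τ C 𝓗 m :=
  hτ.strictTransformIdeal_eq_controlledTransform hW hC hη hint
    (idealOrder_genericPoint_eq_of_le_pow_of_not_controlledTransform_le hW hC hη hle hτ hnot) h𝓗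

/-- The same, with the generic point produced from connectedness of the regular centre (tree:
`Scheme.IsRegular.exists_isGenericPoint_support_of_isPreconnected`) — the form matching `IsWeightedSeqJR.cons`'s
`IsPreconnected (C.support : Set _)`; an EMPTY centre is excluded by `hne`. [cite: Kollar2007, 3.30.2] -/
theorem strictTransformIdeal_eq_controlledTransform_of_isPreconnected [IsLocallyNoetherian W] [NoetherianSpace W]
    (hW : Scheme.IsRegular W) (hC : Scheme.IsRegular C.subscheme) (hconn : _root_.IsPreconnected (C.support : Set W))
    (hne : (C.support : Set W).Nonempty) (hint : interior (C.support : Set W) = ∅) (h𝓗 : IsEffectiveCartier 𝓗)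
    (hle : 𝓗 ≤ C ^ m) (hτ : IsBlowup τ C) (hnot : ¬ controlledTransform τ C 𝓗 m ≤ C.comap τ) :
    strictTransformIdeal τ C 𝓗 = controlledTransform τ C 𝓗 m := by
  obtain ⟨η, hη⟩ := Scheme.IsRegular.exists_isGenericPoint_support_of_isPreconnected hC hconn hne
  exact strictTransformIdeal_eq_controlledTransform_of_le_pow_of_not_le_comap hW hC hη hint h𝓗 hle hτ hnot

end DepthOrder

end Summit.ResolutionOfSingularities.ResolutionOfSingularities.Theorems

end
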